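import Summits.BirchSwinnertonDyer.BirchSwinnertonDyer.Theorems.PrintCFramBottomClassIndexLawFiveLeParitySplitPrimitivityFieldFactor
import Summits.BirchSwinnertonDyer.BirchSwinnertonDyer.Theorems.PrintCFramBottomClassIndexLawFiveLeLevelDictionaryBetaNoB0
import Literature.NumberTheory.EllipticCurves.IsogenyIdProofs
import HarnessLib

/-!
# Crux `PrintCFram.BottomClassIndexLawFiveLe` (stmt-BirchSwinnertonDyer-20372), line `eisenstein-resource-bdp-line` (registry v19):
# THE Ш-CURRENCY READING OF STUB C — a `Ш[p]`-trivial Heegner twist pair makes the `K''`-factor a unit, so registry v19's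
# Stub C `stub_heegnerField_of_unitClassFactor` follows VERBATIM from «every rank-one class member has ONE admissible Heegner
# twist `W^{(d)}` with `L(W^{(d)},1) ≠ 0` and `Ш[p] = 0` on the twist's rational `p`-isogeny class»
# (cell `bsd-print-cfram`, width seat `bsd-line-cfram-p1-w5` g4; THEOREMS ONLY, `--supports` 20372; BSD is not proved by any of this)

HONEST FRAMING. THEOREMS ONLY (0 defs / 0 facts / 0 sorry); nothing about BSD is proved; no stub is closed; no summit statement is
proved by this seat; the crux C2 stays OPEN and is NOT claimed false. This is the step w5 g3 named in
`…LevelDictionaryBetaShaAn` («C follows from ONE admissible `d` with `L(W^{(d)},1) ≠ 0` and `p ∤ #Ш_an` on both models») and the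
LEAD g10 ADDENDUM 1 («B2′/C is an `L`-value statement»), done in the currency the LEAD g11 END STATE `…EisensteinEndStateV19Binders`
already uses for B1 (`Ш(W)[p]`, the level `n_W`): NO Bernoulli number and NO Dirichlet character in the supply statement.

MECHANISM (all landed sockets, composed): a globally minimal model `Wd` of the twist `W^{(d_{K''})}` of a class member is a class
member (w3 g9 `ParitySplit.hasCM_and_cmRamified_of_smul_quadraticTwist`), so it carries its own ODD datum `(f', ψ', ω')` with the
trace congruence (`OffLocusDictionary.exists_krizLiTriple_odd_of_cmRamified`); its CLASS factor `B_{1,ψ'⁻¹}` IS the FIELD factor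
`B_{1,(ψε_{K''}ω⁻¹)~}` of `(W, K'')` (w3 g7 `OffLocusTwistFactor.classFactor_twist_eq_fieldFactor`, read through `LFunction_smul` /
`conductorNorm_smul_rat`); so a NON-unit field factor makes the RANK-ZERO member `Wd` (`L(W^{(d)},1) ≠ 0`, GZK) Eisenstein-IRREGULAR,
and the (β) rank-zero form (w5 g3 / w4 g9 `LevelDictionaryBeta.sha_or_partner_sha_of_classFactor_of_finite_noB0`, Mazur–Wiles Thm. 2
in the Ribet direction) puts a non-zero class in `Ш(Wd)[p]` or in `Ш(W₁)[p]` for a globally minimal CM-ramified `p`-isogenous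
partner `W₁` of `Wd` — contradicting a `Ш[p]`-trivial twist pair.

* §1 **`not_fieldFactor_le_of_twist_noPTorsion_pair`** — class member `W` (CM, `CMRamified W p`, `p ≥ 5`) with odd datum
  `(f, ψ, ω)` + `hss`, `K''` imaginary quadratic with Kronecker `ε`, a globally minimal `C • W.quadraticTwist d_{K''} = Wd` with
  `L(W^{(d)},1) ≠ 0`, `Ш(Wd)[p] = 0`, and `Ш(W₁)[p] = 0` for every globally minimal CM-ramified `p`-isogenous partner `W₁` of `Wd`
  ⊢ `¬ ‖B_{1,(ψεω⁻¹)~}‖ ≤ p⁻¹` (UNIT FIELD FACTOR). Conditional on `hMW` (Mazur–Wiles Thm. 2) and `hGZK` only.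
  `…_of_isogenyClass` — the same with the cleaner supply «`Ш(V)[p] = 0` for every elliptic `V` isogenous to `Wd` over `ℚ`».
* §2 **`stubC_of_heegnerTwistShaSupply`** — registry v19's Stub C VERBATIM (binders copied from the registered signature) from
  **C_Ш**: «for every class member with `r_an = 1` there are an imaginary quadratic `K''`, Heegner for `N_W`, `d_{K''}` odd `< −4`,
  with `L(W^{(d_{K''})},1) ≠ 0`, and a globally minimal model `Wd` of the twist whose rational `p`-isogeny class is `Ш[p]`-trivial»;
  `stubC_of_heegnerTwistShaSupply_isogenyClass` (isogeny-class form); `stubC_of_heegnerTwistShaSupply_binders` (the supplier may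
  also use Stub C's own binders: the odd datum and the UNIT class factor).

READING for the LEAD / planner: with LEAD g11's `…V19Binders` (B1 ⟺ B1-level ∧ B1-sha) the line's END STATE reads
«crux ⟸ prints4 ∧ MW Thm 2 ∧ KL Thm 1.20 ∧ C_Ш ∧ B1-level ∧ B1-sha» — ALL THREE research residues as statements about `Ш[p]`
and the level of CLASS MEMBERS (the class is closed under admissible quadratic twists): C_Ш «every regular rank-one member has a
rank-zero Heegner twist pair with `Ш[p] = 0`», B1-level «`BSD_p` when the generator is `p`-divisible in `W(ℚ_p)`», B1-sha «`BSD_p`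
when `Ш(W)[p] ≠ 0`». beyond-print theorem: NO (composition of landed sockets). CONDITIONAL on the named facts.
References: [MazurWiles1984] Thm. 2; [KrizLi2019] Thm. 1.20 (p. 8), §2 (pp. 11–12), §7.1 (p. 43); [GrossZagier1986] I.(6.3);
[SilvermanAEC2009] X.5 Cor. 5.4; crux workfiles `Lines/eisenstein-resource-bdp-line-lead-g11.md` (ADDENDUM), `…-w3g9-notes.md`,
HOME/HANDOFF §line-cfram-p1-w5 g3 FINAL.
-/

set_option autoImplicit false
-- `…BirchSwinnertonDyer.BirchSwinnertonDyer.Theorems…` is the problem's mandated namespace (D-0017).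
set_option linter.dupNamespace false

noncomputable section

open scoped Classical

namespace Summit.BirchSwinnertonDyer.BirchSwinnertonDyer.Theorems.PrintCFram.HeegnerTwistSha

open WeierstrassCurve NumberField IsDedekindDomain DirichletCharacter
  Literature.NumberTheory.EllipticCurves
  Literature.NumberTheory.EllipticCurves.Rank1Residual
  Literature.NumberTheory.EllipticCurves.KrizLi2019
  Literature.NumberTheory.NumberFields
  Summit.BirchSwinnertonDyer.BirchSwinnertonDyer.Theorems.PrintCFram

/-! ## §1 A `Ш[p]`-trivial Heegner twist pair makes the field factor a unit -/

/-- **UNIT FIELD FACTOR FROM A `Ш[p]`-TRIVIAL TWIST PAIR.** Let `W/ℚ` be elliptic with CM, `p ≥ 5` ramified in the CM field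
(`CMRamified W p`), `(f, ψ, ω)` a character datum for `W` with `ψ` ODD, `ω` Teichmüller and the trace congruence `hss` at every prime
`ℓ ∤ pN_W`; let `K` be imaginary quadratic with Kronecker character `ε_K`, and `Wd` a globally minimal model of the twist `W^{(d_K)}`
(`C • W.quadraticTwist d_K = Wd`) with `L(W^{(d_K)},1) ≠ 0`. If `Ш(Wd/ℚ)[p] = 0` and `Ш(W₁/ℚ)[p] = 0` for every globally minimal,
CM, CM-ramified `W₁` admitting a `p`-isogeny `Wd → W₁`, then the FIELD FACTOR of `(W, K)` is a UNIT: `¬ ‖B_{1,(ψε_Kω⁻¹)~}‖_p ≤ p⁻¹`.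
Proof: `Wd` is a class member with its own odd datum `ψ'`; its class factor `B_{1,ψ'⁻¹}` equals the field factor
(`OffLocusTwistFactor.classFactor_twist_eq_fieldFactor`); `r_an(Wd) = 0` so `Wd(ℚ)` is finite (GZK); a non-unit class factor would give
a non-zero `p`-torsion class in `Ш(Wd)` or in `Ш(W₁)` of a partner (`LevelDictionaryBeta.sha_or_partner_sha_of_classFactor_of_finite_noB0`,
Mazur–Wiles). CONDITIONAL on `hMW`, `hGZK`; closes no stub. [cite: MazurWiles1984, Thm. 2 (p. 216)]
[cite: KrizLi2019, Thm. 1.20 (p. 8), §2 (p. 11) and §7.1 (p. 43)] [cite: GrossZagier1986, Thm. I.(6.3)] [cite: SilvermanAEC2009, X.5 Cor. 5.4] -/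
theorem not_fieldFactor_le_of_twist_noPTorsion_pair {p : ℕ} [Fact p.Prime]
    (hMW : MazurWiles1984.thm2_card_oddChiClassGroup_eq_bernoulli)
    (hGZK : rank_eq_analyticRank_of_analyticRank_le_one)
    (W : WeierstrassCurve ℚ) [W.IsElliptic] (hCM : W.HasCM) (hram : CMRamified W p) (h5 : 5 ≤ p)
    {f : ℕ} [NeZero f] (ψ : DirichletCharacter ℚ_[p] f) (ω : DirichletCharacter ℚ_[p] p)
    (hψ : ψ.Odd) (hω : IsTeichmullerCharacter ω)
    (hss : ∀ ℓ : ℕ, ℓ.Prime → ¬ (ℓ ∣ p * W.conductorNorm ℤ) →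
      ‖((W.LFunction ℓ : ℤ) : ℚ_[p]) - (ψ (ℓ : ZMod f) + ψ⁻¹ (ℓ : ZMod f) * ω (ℓ : ZMod p))‖ < 1)
    (K : Type) [Field K] [NumberField K] (hK : IsImaginaryQuadratic K)
    (εK : DirichletCharacter ℚ_[p] (NumberField.discr K).natAbs) (hεK : IsKroneckerCharacterOf K εK)
    (Wd : WeierstrassCurve ℚ) [Wd.IsElliptic] [Wd.IsGloballyMinimal]
    (hC : ∃ C : VariableChange ℚ, C • W.quadraticTwist (NumberField.discr K : ℚ) = Wd)
    (hLt : (W.quadraticTwist (NumberField.discr K : ℚ)).entireLFunction 1 ≠ 0)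
    (hsha : ∀ c ∈ Wd.sha, p • c = 0 → c = 0)
    (hsha₁ : ∀ (W₁ : WeierstrassCurve ℚ) [W₁.IsElliptic] [W₁.IsGloballyMinimal], W₁.HasCM → CMRamified W₁ p →
      (∃ φ : Isogeny Wd W₁, φ.degree = p) → ∀ c ∈ W₁.sha, p • c = 0 → c = 0) :
    ¬ ‖bernoulliOnePrim (bernoulliCharTwo ψ εK ω)‖ ≤ (p : ℝ)⁻¹ := by
  intro hfld
  have hD0 : (NumberField.discr K : ℚ) ≠ 0 := by exact_mod_cast NumberField.discr_ne_zero K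
  obtain ⟨hCMd, hramd⟩ := ParitySplit.hasCM_and_cmRamified_of_smul_quadraticTwist W hCM hram hD0 Wd hC
  -- the twist's own odd datum
  obtain ⟨f', hf', ψ', ω', -, -, hψ', hω', hss', -, -, -, -⟩ :=
    OffLocusDictionary.exists_krizLiTriple_odd_of_cmRamified Wd p hCMd hramd h5 K hK.1
  haveI := hf'
  obtain ⟨C, rfl⟩ := hC
  haveI : (W.quadraticTwist (NumberField.discr K : ℚ)).IsElliptic := W.isElliptic_quadraticTwist hD0
  -- the same datum read on the literal twist `W.quadraticTwist d_K` (`a_ℓ` and `N` are isomorphism invariants)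
  have hssX : ∀ ℓ : ℕ, ℓ.Prime → ¬ (ℓ ∣ p * (W.quadraticTwist (NumberField.discr K : ℚ)).conductorNorm ℤ) →
      ‖(((W.quadraticTwist (NumberField.discr K : ℚ)).LFunction ℓ : ℤ) : ℚ_[p]) -
        (ψ' (ℓ : ZMod f') + ψ'⁻¹ (ℓ : ZMod f') * ω' (ℓ : ZMod p))‖ < 1 := by
    intro ℓ hℓ hℓN
    have hN : (C • W.quadraticTwist (NumberField.discr K : ℚ)).conductorNorm ℤ =
        (W.quadraticTwist (NumberField.discr K : ℚ)).conductorNorm ℤ :=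
      conductorNorm_smul_rat (W.quadraticTwist (NumberField.discr K : ℚ)) C
    have hL : (C • W.quadraticTwist (NumberField.discr K : ℚ)).LFunction =
        (W.quadraticTwist (NumberField.discr K : ℚ)).LFunction :=
      LFunction_smul (W.quadraticTwist (NumberField.discr K : ℚ)) C
    have h := hss' ℓ hℓ (by rw [hN]; exact hℓN)
    rw [hL] at h
    exact h
  -- the twist's class factor IS the field factor, hence a NON-unit under `hfld`
  have hcls' : ‖bernoulliOnePrim ψ'⁻¹‖ ≤ (p : ℝ)⁻¹ := by
    rw [OffLocusTwistFactor.classFactor_twist_eq_fieldFactor W h5 ψ ω hψ hω hss K hK εK hεK ψ' ω' hψ' hω' hssX]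
    exact hfld
  -- `r_an(Wd) = 0`, so `Wd(ℚ)` is finite (GZK)
  have hLd1 : (C • W.quadraticTwist (NumberField.discr K : ℚ)).entireLFunction 1 ≠ 0 := by
    rw [entireLFunction_smul]; exact hLt
  have hrd : (C • W.quadraticTwist (NumberField.discr K : ℚ)).analyticRank = 0 :=
    analyticRank_eq_zero_of_entireLFunction_one_ne_zero _ hLd1
  have hrank : (C • W.quadraticTwist (NumberField.discr K : ℚ)).mordellWeilRank = 0 := by
    rw [(hGZK (C • W.quadraticTwist (NumberField.discr K : ℚ)) (by rw [hrd]; exact zero_le_one)).1, hrd]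
  have hfin : Finite (C • W.quadraticTwist (NumberField.discr K : ℚ)).toAffine.Point :=
    (C • W.quadraticTwist (NumberField.discr K : ℚ)).mordellWeilRank_eq_zero_iff_holds.mp hrank
  -- (β), rank-zero form, on the twist: `Ш[p] ≠ 0` on `Wd` or on its partner
  rcases LevelDictionaryBeta.sha_or_partner_sha_of_classFactor_of_finite_noB0 (C • W.quadraticTwist (NumberField.discr K : ℚ))
      hMW hCMd hramd h5 hfin ψ' ω' hψ' hω' hss' hcls' with
    ⟨c, hc, hc0, hpc⟩ | ⟨W₁, iW₁, iW₁', hCM₁, hram₁, hφ, -, c, hc, hc0, hpc⟩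
  · exact hc0 (hsha c hc hpc)
  · exact hc0 (hsha₁ W₁ hCM₁ hram₁ hφ c hc hpc)

/-- **UNIT FIELD FACTOR FROM A `Ш[p]`-TRIVIAL RATIONAL ISOGENY CLASS OF THE TWIST** — `not_fieldFactor_le_of_twist_noPTorsion_pair`
with the cleaner supply «`Ш(V/ℚ)[p] = 0` for every elliptic `V` isogenous to `Wd` over `ℚ`» (which covers `Wd` itself,
`IsIsogenous.refl_holds`, and every `p`-isogenous partner). CONDITIONAL on `hMW`, `hGZK`; closes no stub.
[cite: MazurWiles1984, Thm. 2 (p. 216)] [cite: KrizLi2019, Thm. 1.20 (p. 8) and §7.1 (p. 43)] [cite: SilvermanAEC2009, III.4 Example 4.1 and X.5 Cor. 5.4] -/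
theorem not_fieldFactor_le_of_twist_noPTorsion_isogenyClass {p : ℕ} [Fact p.Prime]
    (hMW : MazurWiles1984.thm2_card_oddChiClassGroup_eq_bernoulli)
    (hGZK : rank_eq_analyticRank_of_analyticRank_le_one)
    (W : WeierstrassCurve ℚ) [W.IsElliptic] (hCM : W.HasCM) (hram : CMRamified W p) (h5 : 5 ≤ p)
    {f : ℕ} [NeZero f] (ψ : DirichletCharacter ℚ_[p] f) (ω : DirichletCharacter ℚ_[p] p)
    (hψ : ψ.Odd) (hω : IsTeichmullerCharacter ω)
    (hss : ∀ ℓ : ℕ, ℓ.Prime → ¬ (ℓ ∣ p * W.conductorNorm ℤ) →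
      ‖((W.LFunction ℓ : ℤ) : ℚ_[p]) - (ψ (ℓ : ZMod f) + ψ⁻¹ (ℓ : ZMod f) * ω (ℓ : ZMod p))‖ < 1)
    (K : Type) [Field K] [NumberField K] (hK : IsImaginaryQuadratic K)
    (εK : DirichletCharacter ℚ_[p] (NumberField.discr K).natAbs) (hεK : IsKroneckerCharacterOf K εK)
    (Wd : WeierstrassCurve ℚ) [Wd.IsElliptic] [Wd.IsGloballyMinimal]
    (hC : ∃ C : VariableChange ℚ, C • W.quadraticTwist (NumberField.discr K : ℚ) = Wd)
    (hLt : (W.quadraticTwist (NumberField.discr K : ℚ)).entireLFunction 1 ≠ 0)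
    (hshaI : ∀ (V : WeierstrassCurve ℚ) [V.IsElliptic], IsIsogenous Wd V → ∀ c ∈ V.sha, p • c = 0 → c = 0) :
    ¬ ‖bernoulliOnePrim (bernoulliCharTwo ψ εK ω)‖ ≤ (p : ℝ)⁻¹ :=
  not_fieldFactor_le_of_twist_noPTorsion_pair hMW hGZK W hCM hram h5 ψ ω hψ hω hss K hK εK hεK Wd hC hLt
    (hshaI Wd (IsIsogenous.refl_holds Wd)) (fun W₁ _ _ _ _ hφ ↦ hshaI W₁ (by obtain ⟨φ, -⟩ := hφ; exact ⟨φ⟩))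

/-! ## §2 Stub C from the Ш-currency supply statement -/

/-- **STUB C ⟸ C_Ш.** Registry v19's Stub C `stub_heegnerField_of_unitClassFactor` — VERBATIM, binders copied from the registered
signature (crux stmt-BirchSwinnertonDyer-20372, skeleton 247d0e74daa92c92) — follows from the Ш-CURRENCY SUPPLY STATEMENT **C_Ш**:
«for every globally minimal CM curve `W/ℚ`, `p ≥ 5` CM-ramified, `r_an(W) = 1`, there are an imaginary quadratic `K` satisfying the
Heegner hypothesis for `N_W` with `d_K` odd, `d_K < −4` and `L(W^{(d_K)},1) ≠ 0`, and a globally minimal model `Wd` of the twist with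
`Ш(Wd)[p] = 0` and `Ш(W₁)[p] = 0` for every globally minimal CM-ramified `p`-isogenous partner `W₁` of `Wd`». The Kronecker character
is supplied by `OffLocusDictionary.exists_isKroneckerCharacterOf`; the unit field factor by §1. NO Bernoulli number and NO character occur
in C_Ш. CONDITIONAL on `hMW`, `hGZK`; closes no stub; BSD is not proved by any of this. [cite: MazurWiles1984, Thm. 2 (p. 216)]
[cite: KrizLi2019, Thm. 1.20 (p. 8), §2 (pp. 11–12), §7.1 (p. 43) and §8] [cite: GrossZagier1986, Thm. I.(6.3)] -/
theorem stubC_of_heegnerTwistShaSupply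
    (hMW : MazurWiles1984.thm2_card_oddChiClassGroup_eq_bernoulli)
    (hGZK : rank_eq_analyticRank_of_analyticRank_le_one)
    (hSupply : ∀ (W : WeierstrassCurve ℚ) [W.IsElliptic] [W.IsGloballyMinimal] (p : ℕ) [Fact p.Prime],
      W.HasCM → CMRamified W p → 5 ≤ p → W.analyticRank = 1 →
      ∃ (K : Type) (_ : Field K) (_ : NumberField K), IsImaginaryQuadratic K ∧
        SatisfiesHeegnerHypothesis (W.conductorNorm ℤ) K ∧ Odd (NumberField.discr K) ∧ NumberField.discr K < -4 ∧
        (W.quadraticTwist (NumberField.discr K : ℚ)).entireLFunction 1 ≠ 0 ∧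
        ∃ (Wd : WeierstrassCurve ℚ) (_ : Wd.IsElliptic) (_ : Wd.IsGloballyMinimal),
          (∃ C : VariableChange ℚ, C • W.quadraticTwist (NumberField.discr K : ℚ) = Wd) ∧
          (∀ c ∈ Wd.sha, p • c = 0 → c = 0) ∧
          (∀ (W₁ : WeierstrassCurve ℚ) [W₁.IsElliptic] [W₁.IsGloballyMinimal], W₁.HasCM → CMRamified W₁ p →
            (∃ φ : Isogeny Wd W₁, φ.degree = p) → ∀ c ∈ W₁.sha, p • c = 0 → c = 0)) :
    ∀ (W : WeierstrassCurve ℚ) [W.IsElliptic] [W.IsGloballyMinimal] (p : ℕ) [Fact p.Prime], W.HasCM → CMRamified W p → 5 ≤ p →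
      W.analyticRank = 1 → ∀ (f : ℕ) [NeZero f] (ψ : DirichletCharacter ℚ_[p] f) (ω : DirichletCharacter ℚ_[p] p), ψ.Odd →
      IsTeichmullerCharacter ω →
      (∀ ℓ : ℕ, ℓ.Prime → ¬ (ℓ ∣ p * W.conductorNorm ℤ) →
        ‖((W.LFunction ℓ : ℤ) : ℚ_[p]) - (ψ (ℓ : ZMod f) + ψ⁻¹ (ℓ : ZMod f) * ω (ℓ : ZMod p))‖ < 1) →
      ¬ ‖bernoulliOnePrim ψ⁻¹‖ ≤ (p : ℝ)⁻¹ →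
      ∃ (K : Type) (_ : Field K) (_ : NumberField K) (εK : DirichletCharacter ℚ_[p] (NumberField.discr K).natAbs),
        IsImaginaryQuadratic K ∧ SatisfiesHeegnerHypothesis (W.conductorNorm ℤ) K ∧ Odd (NumberField.discr K) ∧
        NumberField.discr K < -4 ∧ IsKroneckerCharacterOf K εK ∧
        ¬ ‖bernoulliOnePrim (bernoulliCharTwo ψ εK ω)‖ ≤ (p : ℝ)⁻¹ := by
  intro W _ _ p _ hCM hram h5 hr f _ ψ ω hψ hω hss _hcls
  obtain ⟨K, iK, iK', hK, hH, hodd, hd4, hLt, Wd, iWd, iWd', hC, hsha, hsha₁⟩ := hSupply W p hCM hram h5 hr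
  obtain ⟨εK, hεK⟩ := OffLocusDictionary.exists_isKroneckerCharacterOf (p := p) hK.1
  exact ⟨K, iK, iK', εK, hK, hH, hodd, hd4, hεK,
    not_fieldFactor_le_of_twist_noPTorsion_pair hMW hGZK W hCM hram h5 ψ ω hψ hω hss K hK εK hεK Wd hC hLt hsha hsha₁⟩

/-- **STUB C ⟸ C_Ш, ISOGENY-CLASS FORM.** As `stubC_of_heegnerTwistShaSupply`, with the supply's `Ш` clause stated as
«`Ш(V/ℚ)[p] = 0` for every elliptic `V/ℚ` isogenous over `ℚ` to the minimal twist model `Wd`». CONDITIONAL on `hMW`, `hGZK`;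
closes no stub. [cite: MazurWiles1984, Thm. 2 (p. 216)] [cite: KrizLi2019, Thm. 1.20 (p. 8) and §8] [cite: GrossZagier1986, Thm. I.(6.3)] -/
theorem stubC_of_heegnerTwistShaSupply_isogenyClass
    (hMW : MazurWiles1984.thm2_card_oddChiClassGroup_eq_bernoulli)
    (hGZK : rank_eq_analyticRank_of_analyticRank_le_one)
    (hSupply : ∀ (W : WeierstrassCurve ℚ) [W.IsElliptic] [W.IsGloballyMinimal] (p : ℕ) [Fact p.Prime],
      W.HasCM → CMRamified W p → 5 ≤ p → W.analyticRank = 1 →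
      ∃ (K : Type) (_ : Field K) (_ : NumberField K), IsImaginaryQuadratic K ∧
        SatisfiesHeegnerHypothesis (W.conductorNorm ℤ) K ∧ Odd (NumberField.discr K) ∧ NumberField.discr K < -4 ∧
        (W.quadraticTwist (NumberField.discr K : ℚ)).entireLFunction 1 ≠ 0 ∧
        ∃ (Wd : WeierstrassCurve ℚ) (_ : Wd.IsElliptic) (_ : Wd.IsGloballyMinimal),
          (∃ C : VariableChange ℚ, C • W.quadraticTwist (NumberField.discr K : ℚ) = Wd) ∧
          ∀ (V : WeierstrassCurve ℚ) [V.IsElliptic], IsIsogenous Wd V → ∀ c ∈ V.sha, p • c = 0 → c = 0) :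
    ∀ (W : WeierstrassCurve ℚ) [W.IsElliptic] [W.IsGloballyMinimal] (p : ℕ) [Fact p.Prime], W.HasCM → CMRamified W p → 5 ≤ p →
      W.analyticRank = 1 → ∀ (f : ℕ) [NeZero f] (ψ : DirichletCharacter ℚ_[p] f) (ω : DirichletCharacter ℚ_[p] p), ψ.Odd →
      IsTeichmullerCharacter ω →
      (∀ ℓ : ℕ, ℓ.Prime → ¬ (ℓ ∣ p * W.conductorNorm ℤ) →
        ‖((W.LFunction ℓ : ℤ) : ℚ_[p]) - (ψ (ℓ : ZMod f) + ψ⁻¹ (ℓ : ZMod f) * ω (ℓ : ZMod p))‖ < 1) →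
      ¬ ‖bernoulliOnePrim ψ⁻¹‖ ≤ (p : ℝ)⁻¹ →
      ∃ (K : Type) (_ : Field K) (_ : NumberField K) (εK : DirichletCharacter ℚ_[p] (NumberField.discr K).natAbs),
        IsImaginaryQuadratic K ∧ SatisfiesHeegnerHypothesis (W.conductorNorm ℤ) K ∧ Odd (NumberField.discr K) ∧
        NumberField.discr K < -4 ∧ IsKroneckerCharacterOf K εK ∧
        ¬ ‖bernoulliOnePrim (bernoulliCharTwo ψ εK ω)‖ ≤ (p : ℝ)⁻¹ := by
  intro W _ _ p _ hCM hram h5 hr f _ ψ ω hψ hω hss _hcls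
  obtain ⟨K, iK, iK', hK, hH, hodd, hd4, hLt, Wd, iWd, iWd', hC, hshaI⟩ := hSupply W p hCM hram h5 hr
  obtain ⟨εK, hεK⟩ := OffLocusDictionary.exists_isKroneckerCharacterOf (p := p) hK.1
  exact ⟨K, iK, iK', εK, hK, hH, hodd, hd4, hεK,
    not_fieldFactor_le_of_twist_noPTorsion_isogenyClass hMW hGZK W hCM hram h5 ψ ω hψ hω hss K hK εK hεK Wd hC hLt hshaI⟩

/-- **STUB C ⟸ C_Ш♭ (THE SUPPLIER MAY USE STUB C's OWN BINDERS).** As `stubC_of_heegnerTwistShaSupply`, but the supply statement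
receives, besides `r_an(W) = 1`, the class's odd datum `(f, ψ, ω)` with `hss` and the UNIT CLASS FACTOR `¬ ‖B_{1,ψ⁻¹}‖ ≤ p⁻¹`
(Eisenstein-regularity of `W`) — exactly Stub C's binders — and returns the Ш-currency conclusion; so C_Ш♭ is Stub C with ONLY its
conclusion rewritten («`Ш[p]`-trivial admissible twist pair with `L ≠ 0`» for «admissible `K''` with unit field factor»).
CONDITIONAL on `hMW`, `hGZK`; closes no stub. [cite: MazurWiles1984, Thm. 2 (p. 216)] [cite: KrizLi2019, Thm. 1.20 (p. 8) and §8]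
[cite: GrossZagier1986, Thm. I.(6.3)] -/
theorem stubC_of_heegnerTwistShaSupply_binders
    (hMW : MazurWiles1984.thm2_card_oddChiClassGroup_eq_bernoulli)
    (hGZK : rank_eq_analyticRank_of_analyticRank_le_one)
    (hSupply : ∀ (W : WeierstrassCurve ℚ) [W.IsElliptic] [W.IsGloballyMinimal] (p : ℕ) [Fact p.Prime],
      W.HasCM → CMRamified W p → 5 ≤ p → W.analyticRank = 1 →
      ∀ (f : ℕ) [NeZero f] (ψ : DirichletCharacter ℚ_[p] f) (ω : DirichletCharacter ℚ_[p] p), ψ.Odd →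
      IsTeichmullerCharacter ω →
      (∀ ℓ : ℕ, ℓ.Prime → ¬ (ℓ ∣ p * W.conductorNorm ℤ) →
        ‖((W.LFunction ℓ : ℤ) : ℚ_[p]) - (ψ (ℓ : ZMod f) + ψ⁻¹ (ℓ : ZMod f) * ω (ℓ : ZMod p))‖ < 1) →
      ¬ ‖bernoulliOnePrim ψ⁻¹‖ ≤ (p : ℝ)⁻¹ →
      ∃ (K : Type) (_ : Field K) (_ : NumberField K), IsImaginaryQuadratic K ∧
        SatisfiesHeegnerHypothesis (W.conductorNorm ℤ) K ∧ Odd (NumberField.discr K) ∧ NumberField.discr K < -4 ∧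
        (W.quadraticTwist (NumberField.discr K : ℚ)).entireLFunction 1 ≠ 0 ∧
        ∃ (Wd : WeierstrassCurve ℚ) (_ : Wd.IsElliptic) (_ : Wd.IsGloballyMinimal),
          (∃ C : VariableChange ℚ, C • W.quadraticTwist (NumberField.discr K : ℚ) = Wd) ∧
          (∀ c ∈ Wd.sha, p • c = 0 → c = 0) ∧
          (∀ (W₁ : WeierstrassCurve ℚ) [W₁.IsElliptic] [W₁.IsGloballyMinimal], W₁.HasCM → CMRamified W₁ p →
            (∃ φ : Isogeny Wd W₁, φ.degree = p) → ∀ c ∈ W₁.sha, p • c = 0 → c = 0)) :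
    ∀ (W : WeierstrassCurve ℚ) [W.IsElliptic] [W.IsGloballyMinimal] (p : ℕ) [Fact p.Prime], W.HasCM → CMRamified W p → 5 ≤ p →
      W.analyticRank = 1 → ∀ (f : ℕ) [NeZero f] (ψ : DirichletCharacter ℚ_[p] f) (ω : DirichletCharacter ℚ_[p] p), ψ.Odd →
      IsTeichmullerCharacter ω →
      (∀ ℓ : ℕ, ℓ.Prime → ¬ (ℓ ∣ p * W.conductorNorm ℤ) →
        ‖((W.LFunction ℓ : ℤ) : ℚ_[p]) - (ψ (ℓ : ZMod f) + ψ⁻¹ (ℓ : ZMod f) * ω (ℓ : ZMod p))‖ < 1) →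
      ¬ ‖bernoulliOnePrim ψ⁻¹‖ ≤ (p : ℝ)⁻¹ →
      ∃ (K : Type) (_ : Field K) (_ : NumberField K) (εK : DirichletCharacter ℚ_[p] (NumberField.discr K).natAbs),
        IsImaginaryQuadratic K ∧ SatisfiesHeegnerHypothesis (W.conductorNorm ℤ) K ∧ Odd (NumberField.discr K) ∧
        NumberField.discr K < -4 ∧ IsKroneckerCharacterOf K εK ∧
        ¬ ‖bernoulliOnePrim (bernoulliCharTwo ψ εK ω)‖ ≤ (p : ℝ)⁻¹ := by
  intro W _ _ p _ hCM hram h5 hr f _ ψ ω hψ hω hss hcls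
  obtain ⟨K, iK, iK', hK, hH, hodd, hd4, hLt, Wd, iWd, iWd', hC, hsha, hsha₁⟩ :=
    hSupply W p hCM hram h5 hr f ψ ω hψ hω hss hcls
  obtain ⟨εK, hεK⟩ := OffLocusDictionary.exists_isKroneckerCharacterOf (p := p) hK.1
  exact ⟨K, iK, iK', εK, hK, hH, hodd, hd4, hεK,
    not_fieldFactor_le_of_twist_noPTorsion_pair hMW hGZK W hCM hram h5 ψ ω hψ hω hss K hK εK hεK Wd hC hLt hsha hsha₁⟩

end Summit.BirchSwinnertonDyer.BirchSwinnertonDyer.Theorems.PrintCFram.HeegnerTwistSha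

end
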